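import Summits.PneNP.PneNP.Theses.UncheckableSAT
import Literature.Computability.Complexity.ClayProblemProofs
import Literature.Computability.Complexity.NegCNFTranscoder
import Literature.Computability.Complexity.KSATReductions
import Literature.Computability.Complexity.StringCopy
import Literature.Computability.Complexity.LazySamplingMachine

/-!
# Route UncheckableSAT — `Assembly` (stmt-PneNP-2299)

`X → PneNP` with `X` inlined (no competitive interactive proof for `UNSAT` with an `FP^SAT` prover).
Contrapositive: `¬ PneNP` gives `NP ⊆ P`, hence `SAT ∈ P` (`SAT_mem_NP_holds`, `NP_bool_eq_holds`,
`P_bool_eq_holds`) and `UNSAT = SATᶜ ∩ {CNF codes} ∈ P` (code test `KSATRed.isCanonFn`). The trivial protocol: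
no coins, empty messages, verdict `{v | fst v ∈ UNSAT} ∈ P`, prover `M := const [] ∈ FP ⊆ FP^SAT`; the verifier
ignores the transcript, so it accepts with probability `1` on `UNSAT` and `0` elsewhere, against every prover.
-/

set_option linter.dupNamespace false -- `Summit.PneNP.PneNP.…`: summit = sub-problem name (D-0017 single-conjunct layout)

namespace Summit.PneNP.PneNP.Theorems

open _root_.Computability
open Literature.Computability.Complexity Literature.Computability.Complexity.Brick

/-- `UNSAT` is the intersection of the complement of `SAT` with the set of CNF codes. [cite: AroraBarak2009, §2.6.1] [folklore] -/
theorem uncheckableSAT_UNSAT_eq :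
    UNSAT = SATᶜ ⊓ {w | encodingCNF.encode (NegCNF.decCNF w) = w} := by
  ext w
  constructor
  · rintro ⟨φ, hφ, rfl⟩
    refine ⟨fun h => hφ ((mem_SAT_iff φ).1 h), ?_⟩
    show encodingCNF.encode (NegCNF.decCNF (encodingCNF.encode φ)) = encodingCNF.encode φ
    rw [KSATRed.decCNF_encode]
  · rintro ⟨hS, hw⟩
    refine ⟨NegCNF.decCNF w, fun h => hS ?_, hw⟩
    rw [← (show encodingCNF.encode (NegCNF.decCNF w) = w from hw)]
    exact (mem_SAT_iff _).2 h

/-- The set of CNF codes is in `P` (string equality with the canonical re-encoding). [cite: AroraBarak2009, §1.3] [folklore] -/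
theorem uncheckableSAT_codes_mem_P : ({w | encodingCNF.encode (NegCNF.decCNF w) = w} : Language Bool) ∈ Classes.P :=
  mem_P_of_mem_FP KSATRed.isCanonFn_mem_FP _ fun w =>
    ⟨fun hw => by rw [KSATRed.isCanonFn_apply, decide_eq_true (show encodingCNF.encode (NegCNF.decCNF w) = w from hw)],
     fun hw => by rw [KSATRed.isCanonFn_apply, decide_eq_false (show ¬ encodingCNF.encode (NegCNF.decCNF w) = w from hw)]⟩

/-- Under `SAT ∈ P`, `UNSAT ∈ P`. [cite: AroraBarak2009, §2.6.1] [folklore] -/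
theorem uncheckableSAT_UNSAT_mem_P (hS : SAT ∈ Classes.P) : UNSAT ∈ Classes.P := by
  rw [uncheckableSAT_UNSAT_eq]
  exact inter_mem_P (compl_mem_P_iff.2 hS) uncheckableSAT_codes_mem_P

/-- **Assembly of route UncheckableSAT (stmt-PneNP-2299)**: if no competitive interactive proof for `UNSAT` exists
then `PneNP` — for under `¬ PneNP` the coin-free, message-ignoring verifier with verdict `fst v ∈ UNSAT ∈ P` and the
constant prover `[] ∈ FP ⊆ FP^SAT` accept exactly the members of `UNSAT`, with probability `1`.
[cite: AroraBarakCC2009, §2.6.1, Def. 8.6] -/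
theorem uncheckableSAT_assembly_proof : Summit.PneNP.PneNP.Theses.UncheckableSAT.Assembly := by
  intro hX
  by_contra hne
  apply hX
  -- `¬ PneNP`: `SAT ∈ P`
  have hall : ∀ L : Language Bool, L ∈ PNPWave0.NP Bool → L ∈ PNPWave0.P Bool := by
    intro L hL
    by_contra hLP
    exact hne ⟨L, hL, hLP⟩
  have hSAT : SAT ∈ Classes.P := by
    rw [← show PNPWave0.P Bool = Classes.P from P_bool_eq_holds]
    refine hall SAT ?_
    rw [show PNPWave0.NP Bool = Nondeterministic.NP from NP_bool_eq_holds]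
    exact SAT_mem_NP_holds
  have hU : UNSAT ∈ Classes.P := uncheckableSAT_UNSAT_mem_P hSAT
  -- the trivial protocol
  let V : IPVerifier := ⟨0, 0, fun _ => [], fstF ⁻¹' UNSAT⟩
  have hacc : ∀ (k : ℕ) (x r : List Bool) (P : IPProver), V.Accepts k x r P ↔ x ∈ UNSAT := by
    intro k x r P
    show fstF (IPVerifier.view x r (V.transcript k x r P)) ∈ UNSAT ↔ x ∈ UNSAT
    rw [IPVerifier.view, fstF_boolPair]
  refine ⟨V, 0, fun _ => [], ⟨const_mem_FP [], preimage_mem_P hU fstF_mem_FP⟩,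
    OracleAlg.FP_subset_FPRel_core _ (const_mem_FP []), fun x hx => ?_, fun x hx P => ?_⟩
  · have hset : {r | V.Accepts (x.length ^ 0) x r fun msgs => (fun _ => []) (boolPair x ((encodingList Bool).listBool.encode msgs))} = Set.univ :=
      Set.eq_univ_of_forall fun r => (hacc _ x r _).2 hx
    show (2 / 3 : ℝ) ≤ uniformProb _ _
    rw [hset, uniformProb_univ]
    norm_num
  · have hset : {r | V.Accepts (x.length ^ 0) x r P} = ∅ :=
      Set.eq_empty_of_forall_notMem fun r hr => hx ((hacc _ x r P).1 hr)
    show uniformProb _ _ ≤ (1 / 3 : ℝ)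
    rw [hset, uniformProb_empty]
    norm_num

end Summit.PneNP.PneNP.Theorems
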